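import Literature.Computability.MetaComplexity.RandomCNFFirstMoment

/-!
# PneNP / ExpanderLinearGenerators — cover expansion of random `k`-CNFs at a general ratio
(first moment)

Route `PneNP/ExpanderLinearGenerators`, support for crux stmt-PneNP-11443: the probabilistic input
of `LinGen.randomKCNF_hard_of_linearGeneratorDepthFregeHard` (companion file
`…ExpanderLinearGeneratorsRandomKCNF`). The tree's Chvátal–Szemerédi / Ben-Sasson–Wigderson fixed-radius
first moment for COVER expansion of the random `k`-CNF `F_k(n, Δ n)` (`fixedRadius_term_le`,
`card_le_of_forall_not_isCoverExpander_linear`) is stated at the cover ratio `a = (2k+1)/4`; the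
same computation works for every ratio `7/4 ≤ a ≤ k - 5/4` (the spare exponent `kc - t - c` is
still `≥ c/4`), in particular for `a = 7k/8` (`k ≥ 10`), which is what `(r, 3k/4)`-BOUNDARY
expansion needs (`IsCoverExpander.isBoundaryExpander`).

* `fixedRadius_term_le_gen` — the per-size term;
* `card_le_of_forall_not_isCoverExpander_gen` — the count of non-expanding clause tuples:
  `≤ (32 a B^4 / n) |kClauses k n|^{Δn}` for radius `N` with `a N ≤ n/(2B)^4`, `B = e^{1+a} Δ a`.

References: V. Chvátal, E. Szemerédi, J. ACM 35 (1988), Lemma 1; E. Ben-Sasson, A. Wigderson,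
J. ACM 48 (2001), Lemma 6.6 and §6.
-/

namespace Summit.PneNP.PneNP.Theorems.LinGen

open Filter Topology MeasureTheory Finset Real
open Literature.Computability.Complexity Literature.Computability.MetaComplexity

/-! ### The cover-expansion first moment at a general ratio -/

/-- **The fixed-radius term at cover ratio `a`** (`7/4 ≤ a ≤ k - 5/4`, `B = e^{1+a} Δ a`): for a
family size `c ≥ 1`, the integer `t` with `t < a c ≤ t + 1`, `t ≤ n`, and `a c ≤ n/(2B)^4`,
`C(Δn, c) · C(n, t) · (C(t,k)/C(n,k))^c ≤ (2B)^4 · (a c / n) · 2^{-c}`. (The tree's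
`fixedRadius_term_le` is the case `a = (2k+1)/4`; the proof is the same, the spare exponent
`kc - t - c ≥ c/4` coming from `a ≤ k - 5/4`.) [Ben-Sasson–Wigderson 2001, Lemma 6.6;
Chvátal–Szemerédi 1988, Lemma 1] [folklore] -/
theorem fixedRadius_term_le_gen {k Δ n c t : ℕ} {a B : ℝ} (hΔ : 1 ≤ Δ)
    (ha74 : 7 / 4 ≤ a) (hak : a + 5 / 4 ≤ k) (hB : B = Real.exp (1 + a) * Δ * a) (hc : 1 ≤ c)
    (ht1 : (t : ℝ) < a * c) (ht2 : a * c ≤ t + 1) (htn : t ≤ n)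
    (hy : a * c ≤ n / (2 * B) ^ 4) :
    ((Δ * n).choose c : ℝ) * n.choose t * ((t.choose k : ℝ) / n.choose k) ^ c ≤
      (2 * B) ^ 4 * (a * c / n) * (1 / 2) ^ c := by
  -- adapted from Literature.Computability.MetaComplexity.fixedRadius_term_le (a = (2k+1)/4)
  have hc1 : (1 : ℝ) ≤ c := by exact_mod_cast hc
  have hΔ1 : (1 : ℝ) ≤ Δ := by exact_mod_cast hΔ
  have hapos : 0 < a := by linarith
  have ht0 : 1 ≤ t := by
    have h : (0 : ℝ) < t := by nlinarith
    exact_mod_cast h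
  have ht' : (0 : ℝ) < t := by exact_mod_cast ht0
  have htk : t ≤ k * c := by
    have h : (t : ℝ) ≤ k * c := by nlinarith
    exact_mod_cast h
  have hn : 1 ≤ n := ht0.trans htn
  have hn' : (0 : ℝ) < n := by exact_mod_cast hn
  have htc : t + c < k * c := by
    have h : (t : ℝ) + c < k * c := by nlinarith
    exact_mod_cast h
  -- the spare exponent
  set E : ℕ := k * c - t - c with hE
  have hE1 : 1 ≤ E := by omega
  have hEcast : (E : ℝ) = k * c - t - c := by
    rw [hE, Nat.cast_sub (by omega), Nat.cast_sub (by omega), Nat.cast_mul]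
  have h4E : (c : ℝ) ≤ 4 * E := by
    rw [hEcast]
    have h1 : 4 * (t : ℝ) < (4 * k - 5) * c := by nlinarith
    linarith
  have h4E' : c ≤ 4 * E := by exact_mod_cast h4E
  -- the base `B`
  have hBpos : 0 < B := by rw [hB]; positivity
  have h2B : (1 : ℝ) ≤ 2 * B := by
    rw [hB]
    have h1 : (1 : ℝ) ≤ Real.exp (1 + a) := Real.one_le_exp (by linarith)
    nlinarith [mul_le_mul h1 hΔ1 (by norm_num) (by linarith : (0 : ℝ) ≤ Real.exp (1 + a))]
  have hBe : exp 1 * Δ * a * exp a = B := by rw [hB, Real.exp_add]; ring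
  -- Step A: the closed form
  have hA := term_le_closed_form (m := Δ * n) (k := k) hc ht0 htn htk
  have hx0 : (0 : ℝ) ≤ t / n := by positivity
  have hsplit : ((t : ℝ) / n) ^ (k * c - t) =
      ((t : ℝ) / n) ^ c * (((t : ℝ) / n) * ((t : ℝ) / n) ^ (E - 1)) := by
    have : k * c - t = c + (E - 1 + 1) := by omega
    rw [this, pow_add, pow_succ]
    ring
  have hC1 : (exp 1 * ((Δ * n : ℕ) : ℝ) / c) ^ c * ((t : ℝ) / n) ^ c ≤ (exp 1 * Δ * a) ^ c := by
    rw [← mul_pow]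
    apply pow_le_pow_left₀ (by positivity)
    rw [Nat.cast_mul]
    have h1 : exp 1 * ((Δ : ℝ) * n) / c * (t / n) = exp 1 * Δ * (t / c) := by
      field_simp
    rw [h1]
    have htc' : (t : ℝ) / c ≤ a := by
      rw [div_le_iff₀ (by positivity)]
      linarith
    gcongr
  have hC2 : exp 1 ^ t ≤ (exp a) ^ c := by
    rw [exp_one_pow, ← Real.exp_nat_mul]
    exact Real.exp_le_exp.2 (by nlinarith)
  have hy' : (t : ℝ) / n ≤ ((2 * B) ^ 4)⁻¹ := by
    rw [div_le_iff₀ hn']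
    calc (t : ℝ) ≤ a * c := ht1.le
      _ ≤ n / (2 * B) ^ 4 := hy
      _ = ((2 * B) ^ 4)⁻¹ * n := by rw [div_eq_mul_inv, mul_comm]
  -- the key estimate: `B^c y^{E-1} ≤ (2B)^4 2^{-c}` for `y = (2B)^{-4}`
  have hkey : B ^ c * (((2 * B) ^ 4)⁻¹) ^ (E - 1) ≤ (2 * B) ^ 4 * (1 / 2) ^ c := by
    have e1 : B ^ c = (2 * B) ^ c * (1 / 2) ^ c := by rw [← mul_pow]; congr 1; ring
    have e2 : (2 * B) ^ (4 * E) = (2 * B) ^ 4 * ((2 * B) ^ 4) ^ (E - 1) := by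
      rw [pow_mul]
      conv_lhs => rw [show E = E - 1 + 1 by omega, pow_succ]
      ring
    have h3 : (2 * B) ^ c * (((2 * B) ^ 4)⁻¹) ^ (E - 1) ≤ (2 * B) ^ 4 :=
      calc (2 * B) ^ c * (((2 * B) ^ 4)⁻¹) ^ (E - 1)
          ≤ (2 * B) ^ (4 * E) * (((2 * B) ^ 4)⁻¹) ^ (E - 1) := by
            gcongr
        _ = (2 * B) ^ 4 * ((2 * B) ^ 4 * ((2 * B) ^ 4)⁻¹) ^ (E - 1) := by
            rw [e2, mul_pow ((2 * B) ^ 4) (((2 * B) ^ 4)⁻¹) (E - 1), mul_assoc]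
        _ = (2 * B) ^ 4 := by
            rw [mul_inv_cancel₀ (by positivity), one_pow, mul_one]
    calc B ^ c * (((2 * B) ^ 4)⁻¹) ^ (E - 1)
        = (2 * B) ^ c * (((2 * B) ^ 4)⁻¹) ^ (E - 1) * (1 / 2) ^ c := by rw [e1]; ring
      _ ≤ (2 * B) ^ 4 * (1 / 2) ^ c := by gcongr
  -- assembly
  calc ((Δ * n).choose c : ℝ) * n.choose t * ((t.choose k : ℝ) / n.choose k) ^ c
      ≤ (exp 1 * ((Δ * n : ℕ) : ℝ) / c) ^ c * exp 1 ^ t * ((t : ℝ) / n) ^ (k * c - t) := hA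
    _ = ((exp 1 * ((Δ * n : ℕ) : ℝ) / c) ^ c * ((t : ℝ) / n) ^ c) * exp 1 ^ t *
          (((t : ℝ) / n) * ((t : ℝ) / n) ^ (E - 1)) := by rw [hsplit]; ring
    _ ≤ (exp 1 * Δ * a) ^ c * (exp a) ^ c *
          (((t : ℝ) / n) * (((2 * B) ^ 4)⁻¹) ^ (E - 1)) := by gcongr
    _ = B ^ c * (((2 * B) ^ 4)⁻¹) ^ (E - 1) * ((t : ℝ) / n) := by rw [← mul_pow, hBe]; ring
    _ ≤ (2 * B) ^ 4 * (1 / 2) ^ c * ((t : ℝ) / n) := by gcongr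
    _ ≤ (2 * B) ^ 4 * (1 / 2) ^ c * (a * c / n) := by gcongr
    _ = (2 * B) ^ 4 * (a * c / n) * (1 / 2) ^ c := by ring

/-- **First moment for cover expansion at a general ratio** (`7/4 ≤ a ≤ k - 5/4`,
`B = e^{1+a} Δ a`, radius `N` with `a N ≤ n/(2B)^4`): the tuples of `Δ n` clauses from
`kClauses k n ≠ ∅` whose scope family is not an `(N, a)`-cover expander number at most
`(32 a B^4 / n) |kClauses k n|^{Δn}`. (The tree's `card_le_of_forall_not_isCoverExpander_linear`
is the case `a = (2k+1)/4`.) [Chvátal–Szemerédi 1988, Lemma 1; Ben-Sasson–Wigderson 2001, Lemma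
6.6] [folklore] -/
theorem card_le_of_forall_not_isCoverExpander_gen {k Δ n N : ℕ} {a B : ℝ}
    (hΔ : 1 ≤ Δ) (hn : 1 ≤ n) (hK : (kClauses k n).Nonempty) (ha74 : 7 / 4 ≤ a)
    (hak : a + 5 / 4 ≤ k) (hB : B = Real.exp (1 + a) * Δ * a) (hN : a * N ≤ n / (2 * B) ^ 4)
    (bad : Finset (Fin (Δ * n) → ↥(kClauses k n)))
    (hbad : ∀ c ∈ bad, ¬ IsCoverExpander (fun i => clauseScope (c i : Clause ℕ)) N a) :
    (bad.card : ℝ) ≤ 32 * a * B ^ 4 / n * ((((kClauses k n).card ^ (Δ * n) : ℕ)) : ℝ) := by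
  -- adapted from Literature.Computability.MetaComplexity.card_le_of_forall_not_isCoverExpander_linear
  classical
  have hΔ1 : (1 : ℝ) ≤ Δ := by exact_mod_cast hΔ
  have hn' : (0 : ℝ) < n := by exact_mod_cast hn
  have hapos : 0 < a := by linarith
  have hBpos : 0 < B := by rw [hB]; positivity
  have h2B : (1 : ℝ) ≤ 2 * B := by
    rw [hB]
    have h1 : (1 : ℝ) ≤ Real.exp (1 + a) := Real.one_le_exp (by linarith)
    nlinarith [mul_le_mul h1 hΔ1 (by norm_num) (by linarith : (0 : ℝ) ≤ Real.exp (1 + a))]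
  have h2B4 : (1 : ℝ) ≤ (2 * B) ^ 4 := one_le_pow₀ h2B
  have haN : a * N ≤ n := hN.trans (div_le_self hn'.le h2B4)
  have hcount := card_le_of_forall_not_isCoverExpander (k := k) hapos.le haN bad hbad
  have hKc : (kClauses k n).card = n.choose k * 2 ^ k := card_kClauses k n
  have hKpos : 0 < (kClauses k n).card := card_pos.2 hK
  have hchoose : 0 < n.choose k := by
    refine Nat.pos_of_ne_zero fun h => ?_
    rw [hKc, h, zero_mul] at hKpos
    exact lt_irrefl _ hKpos
  set K : ℝ := ((kClauses k n).card : ℝ) with hKdef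
  have hKreal : K = (n.choose k : ℝ) * 2 ^ k := by rw [hKdef, hKc]; push_cast; ring
  have hch' : (0 : ℝ) < n.choose k := by exact_mod_cast hchoose
  -- the per-size bound
  have hterm : ∀ c ∈ Finset.Ico 1 (N + 1),
      ((Δ * n).choose c : ℝ) * ((n.choose (⌈a * c⌉₊ - 1) : ℝ) *
        ((((⌈a * c⌉₊ - 1).choose k : ℝ) * 2 ^ k) ^ c * K ^ (Δ * n - c))) ≤
      K ^ (Δ * n) * ((2 * B) ^ 4 * (a * c / n) * (1 / 2) ^ c) := by
    intro c hc
    rw [Finset.mem_Ico] at hc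
    obtain ⟨hc1, hcN⟩ := hc
    have hcN' : c ≤ N := Nat.lt_succ_iff.1 hcN
    have hcNr : (c : ℝ) ≤ N := by exact_mod_cast hcN'
    set t : ℕ := ⌈a * c⌉₊ - 1 with htdef
    have hac : 0 < a * c := by positivity
    have hceil : 1 ≤ ⌈a * (c : ℝ)⌉₊ := Nat.one_le_iff_ne_zero.2 (Nat.ceil_pos.2 hac).ne'
    have htcast : (t : ℝ) = ⌈a * (c : ℝ)⌉₊ - 1 := by
      rw [htdef, Nat.cast_sub hceil, Nat.cast_one]
    have ht1 : (t : ℝ) < a * c := by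
      rw [htcast]
      linarith [Nat.ceil_lt_add_one hac.le]
    have ht2 : a * c ≤ t + 1 := by
      rw [htcast]
      linarith [Nat.le_ceil (a * c)]
    have hy : a * c ≤ n / (2 * B) ^ 4 := (mul_le_mul_of_nonneg_left hcNr hapos.le).trans hN
    have htn : t ≤ n := by
      have h1 : a * c ≤ n := (mul_le_mul_of_nonneg_left hcNr hapos.le).trans haN
      have h2 := Nat.ceil_le.2 h1
      omega
    have hT := fixedRadius_term_le_gen hΔ ha74 hak hB hc1 ht1 ht2 htn hy
    by_cases hcm : c ≤ Δ * n
    · have hsplit : K ^ (Δ * n) = K ^ c * K ^ (Δ * n - c) := (pow_mul_pow_sub K hcm).symm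
      have hfac : ((t.choose k : ℝ)) * 2 ^ k = K * ((t.choose k : ℝ) / n.choose k) := by
        rw [hKreal]
        field_simp
      calc ((Δ * n).choose c : ℝ) * ((n.choose t : ℝ) *
            ((((t.choose k : ℝ)) * 2 ^ k) ^ c * K ^ (Δ * n - c)))
          = K ^ (Δ * n) * ((((Δ * n).choose c : ℝ)) * n.choose t *
              ((t.choose k : ℝ) / n.choose k) ^ c) := by
            rw [hfac, mul_pow, hsplit]
            ring
        _ ≤ K ^ (Δ * n) * ((2 * B) ^ 4 * (a * c / n) * (1 / 2) ^ c) :=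
            mul_le_mul_of_nonneg_left hT (by positivity)
    · have h0 : (Δ * n).choose c = 0 := Nat.choose_eq_zero_of_lt (not_le.1 hcm)
      rw [h0, Nat.cast_zero, zero_mul]
      positivity
  -- summing up
  calc (bad.card : ℝ)
      ≤ ∑ c ∈ Finset.Ico 1 (N + 1), ((Δ * n).choose c : ℝ) * ((n.choose (⌈a * c⌉₊ - 1) : ℝ) *
          ((((⌈a * c⌉₊ - 1).choose k : ℝ) * 2 ^ k) ^ c * K ^ (Δ * n - c))) := by
        rw [hKdef]
        exact_mod_cast hcount
    _ ≤ ∑ c ∈ Finset.Ico 1 (N + 1), K ^ (Δ * n) * ((2 * B) ^ 4 * (a * c / n) * (1 / 2) ^ c) :=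
        sum_le_sum hterm
    _ = K ^ (Δ * n) * ((2 * B) ^ 4 * (a / n)) *
          ∑ c ∈ Finset.Ico 1 (N + 1), (c : ℝ) * (1 / 2) ^ c := by
        rw [mul_sum]
        refine sum_congr rfl fun c _ => ?_
        ring
    _ ≤ K ^ (Δ * n) * ((2 * B) ^ 4 * (a / n)) * 2 := by
        gcongr
        exact sum_Ico_mul_half_pow_le_two N
    _ = 32 * a * B ^ 4 / n * ((((kClauses k n).card ^ (Δ * n) : ℕ)) : ℝ) := by
        rw [hKdef]
        push_cast
        ring

end Summit.PneNP.PneNP.Theorems.LinGen
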